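import Mathlib
import HarnessLib
import Summits.Ventures.LatticeQCDFlow.Exactness.TransformedKernel

/-!
# Field-transformed MCMC: convergence rates, set-wise errors and Doeblin constants transfer

HONEST FRAMING: exact (Metropolis-corrected) sampling algorithms for lattice gauge theory;
figures of merit are autocorrelation/cost numbers at stated couplings and volumes; no
continuum-physics claim.

Venture `LatticeQCDFlow` (cell pub-lqcd), topic `Exactness`; FANOUT row 7 (`s0-cpn-null`, S0-D1:
trivializing map inside HMC vs HMC).  NEW WORK of the cell over Mathlib and the tree's
`Exactness/TransformedKernel.lean` (`conjKernel`, `invariant_conjKernel`) and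
`Exactness/RefreshScan.lean` (`uniformlyErgodic_of_minorised`); nothing here is cited as a fact.
Printed counterparts, named only: Lüscher 2010 §2.3 (HMC in transformed variables), Engel–Schaefer
2011 §2, Meyn–Tweedie Thm 16.2.4 (uniform ergodicity from a minorisation).

`TransformedKernel.lean` shows that an exact update `κ` of the `V`-variables REPORTED through a
measurable bijection `F` (`conjKernel κ F x = F_* κ(F⁻¹ x)`; Lüscher's THMC when `κ` is HMC for the
modified action `S̃` and `F` the trivializing map) is exact for `F_*ν`, and that stationary
autocorrelations of `O` are those of `O ∘ F`.  This file adds the CONVERGENCE side: the reported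
chain and the `V`-chain are one chain in two coordinate systems, so every convergence statement
transfers with the SAME constants.

* `map_bind_conjKernel`, `iterate_bind_conjKernel` — the law of the reported chain at time `t`
  started from `F_*μ` is `F_*` of the law of the `V`-chain at time `t` started from `μ`;
* `iterate_bind_conjKernel_real_sub` — for EVERY initial law `μ'`, time `t` and set `A`, the error
  of the time-`t` law against `F_*π` on `A` equals the `V`-chain's error (from `F⁻¹_*μ'`, against
  `π`) on `F⁻¹A`;
* **`conjKernel_rate_transfer`** — hence any set-wise bound `|μκᵗ(B) − π(B)| ≤ r(t)` uniform in the
  initial probability law transfers verbatim: mixing times and exponential autocorrelation times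
  are SHARED by the two chains — "τ_exp of THMC" is τ_exp of the HMC chain for `S̃`, the map
  entering only through `S̃`;
* `conjKernel_minorised` — a Doeblin minorisation `κ a ≥ ε ν'` from every state gives
  `conjKernel κ F x ≥ ε F_*ν'` from every state, same `ε`; **`conjKernel_uniformlyErgodic`** — so a
  minorised `κ` with invariant probability law `π` gives `|μ₀Kᵗ(A) − F_*π(A)| ≤ (1 − ε)ᵗ` for the
  reported chain from every initial law (the tree's `uniformlyErgodic_of_minorised`); e.g. the
  flow-sampler Doeblin constant `e^{−2δ}` of `ApproxTrivializingSampler.lean` survives any change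
  of variables of the chain.

Not here: spectral gaps / `L²` isometry (the conjugation is also a unitary equivalence of the
transition operators; not needed for the set-wise statements), and anything quantitative about a
particular `κ`.
-/

namespace Summit.Ventures.LatticeQCDFlow.Exactness

open MeasureTheory ProbabilityTheory ProbabilityTheory.Kernel
open scoped ENNReal

variable {Ω Ω' : Type*} [MeasurableSpace Ω] [MeasurableSpace Ω']

section Convergence

/-- **One step from a pushed-forward law**: `(F_*μ) K = F_*(μ κ)` for the reported kernel
`K = conjKernel κ F` and every initial law `μ`. -/
theorem map_bind_conjKernel (κ : Kernel Ω Ω) (F : Ω ≃ᵐ Ω') (μ : Measure Ω) :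
    (μ.map F).bind ⇑(conjKernel κ F) = (μ.bind ⇑κ).map F := by
  ext s hs
  rw [Measure.bind_apply hs (Kernel.aemeasurable _), lintegral_map_equiv,
    Measure.map_apply F.measurable hs, Measure.bind_apply (F.measurable hs) (Kernel.aemeasurable _)]
  simp only [conjKernel_apply' _ _ _ hs, MeasurableEquiv.symm_apply_apply]

/-- **`t` steps**: the law of the reported chain at time `t` started from `F_*μ` is `F_*` of the law
of the `V`-chain at time `t` started from `μ`. -/
theorem iterate_bind_conjKernel (κ : Kernel Ω Ω) (F : Ω ≃ᵐ Ω') (μ : Measure Ω) (t : ℕ) :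
    (fun m : Measure Ω' => m.bind ⇑(conjKernel κ F))^[t] (μ.map F) =
      ((fun m : Measure Ω => m.bind ⇑κ)^[t] μ).map F := by
  induction t with
  | zero => rfl
  | succ t ih =>
    rw [Function.iterate_succ_apply', Function.iterate_succ_apply', ih, map_bind_conjKernel]

/-- **Set-wise errors transfer verbatim.**  For every initial law `μ'` of the reported chain, every
time `t` and EVERY set `A`: the error of the time-`t` law against `F_*π` on `A` equals the error of
the `V`-chain started from `F⁻¹_*μ'` against `π` on `F⁻¹ A`. -/
theorem iterate_bind_conjKernel_real_sub (κ : Kernel Ω Ω) (F : Ω ≃ᵐ Ω') (μ' : Measure Ω')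
    (π : Measure Ω) (t : ℕ) (A : Set Ω') :
    ((fun m : Measure Ω' => m.bind ⇑(conjKernel κ F))^[t] μ').real A - (π.map F).real A =
      ((fun m : Measure Ω => m.bind ⇑κ)^[t] (μ'.map F.symm)).real (F ⁻¹' A) - π.real (F ⁻¹' A) := by
  conv_lhs => rw [← MeasurableEquiv.map_map_symm F (ν := μ')]
  rw [iterate_bind_conjKernel, measureReal_def, measureReal_def, measureReal_def, measureReal_def,
    MeasurableEquiv.map_apply, MeasurableEquiv.map_apply]

/-- **Rates transfer.**  If the `V`-chain obeys a set-wise bound `|μκᵗ(B) − π(B)| ≤ r t` uniformly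
in the initial probability law `μ` and the measurable set `B`, the reported chain obeys the same
bound against `F_*π` with the same `r` — mixing times and exponential autocorrelation times are
shared. -/
theorem conjKernel_rate_transfer (κ : Kernel Ω Ω) (F : Ω ≃ᵐ Ω') (π : Measure Ω) (r : ℕ → ℝ)
    (h : ∀ (μ : Measure Ω) [IsProbabilityMeasure μ] (t : ℕ) (B : Set Ω), MeasurableSet B →
      |((fun m : Measure Ω => m.bind ⇑κ)^[t] μ).real B - π.real B| ≤ r t)
    (μ' : Measure Ω') [IsProbabilityMeasure μ'] (t : ℕ) {A : Set Ω'} (hA : MeasurableSet A) :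
    |((fun m : Measure Ω' => m.bind ⇑(conjKernel κ F))^[t] μ').real A - (π.map F).real A| ≤ r t := by
  rw [iterate_bind_conjKernel_real_sub κ F μ' π t A]
  haveI : IsProbabilityMeasure (μ'.map F.symm) :=
    Measure.isProbabilityMeasure_map F.symm.measurable.aemeasurable
  exact h _ t _ (F.measurable hA)

/-- **Doeblin constants transfer.**  A minorisation `κ a ≥ ε ν'` from every state gives
`conjKernel κ F x ≥ ε F_*ν'` from every state, same `ε`. -/
theorem conjKernel_minorised {κ : Kernel Ω Ω} {ν' : Measure Ω} {ε : ℝ≥0∞} (h : ∀ a, ε • ν' ≤ κ a)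
    (F : Ω ≃ᵐ Ω') (x : Ω') : ε • ν'.map F ≤ conjKernel κ F x := by
  refine Measure.le_iff.2 fun s hs => ?_
  rw [Measure.smul_apply, Measure.map_apply F.measurable hs, conjKernel_apply' _ _ _ hs]
  have hx := Measure.le_iff.1 (h (F.symm x)) (F ⁻¹' s) (F.measurable hs)
  rwa [Measure.smul_apply] at hx

/-- **Uniform ergodicity of the reported chain at the `V`-chain's rate.**  If the Markov kernel `κ`
is minorised, `κ a ≥ ε ν'` (`ν'` a probability law), and leaves the probability law `π` invariant,
then for every initial law `μ₀` of the reported chain, every `t` and every set `A`,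
`|μ₀Kᵗ(A) − (F_*π)(A)| ≤ (1 − ε)ᵗ`, `K = conjKernel κ F` — the tree's
`uniformlyErgodic_of_minorised` applied to the transferred minorisation and invariance.  (E.g. the
flow-sampler Doeblin constant `e^{−2δ}` of `ApproxTrivializingSampler.lean` survives any change of
variables of the chain.) -/
theorem conjKernel_uniformlyErgodic {κ : Kernel Ω Ω} [IsMarkovKernel κ] {ν' : Measure Ω}
    [IsProbabilityMeasure ν'] {ε : ℝ≥0∞} (h : ∀ a, ε • ν' ≤ κ a) {π : Measure Ω}
    [IsProbabilityMeasure π] (hπ : Invariant κ π) (F : Ω ≃ᵐ Ω') (μ₀ : Measure Ω')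
    [IsProbabilityMeasure μ₀] (t : ℕ) (A : Set Ω') :
    |((fun m : Measure Ω' => m.bind ⇑(conjKernel κ F))^[t] μ₀).real A - (π.map F).real A| ≤
      (1 - ε.toReal) ^ t := by
  haveI : IsProbabilityMeasure (ν'.map F) := Measure.isProbabilityMeasure_map F.measurable.aemeasurable
  haveI : IsProbabilityMeasure (π.map F) := Measure.isProbabilityMeasure_map F.measurable.aemeasurable
  exact uniformlyErgodic_of_minorised (conjKernel_minorised h F) (invariant_conjKernel hπ F) μ₀ t A

end Convergence

end Summit.Ventures.LatticeQCDFlow.Exactness
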